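import Literature.MathematicalPhysics.QuantumLattice.ReducedBCSTorus
import HarnessLib

/-!
# The `d`-wave form-factor sum `Φ_L = Σ_k |cos k₁ - cos k₂| ≤ 8L²/π²` (odd `L`)

pub-hubbard r3 — rung 0′ of the R4 ceiling ladder (R4-MEMO §9.10). HONEST FRAMING: ladder R1–R4
with certified numbers; no claim on H/H₀. NEW cell-side mathematics (not a published result), staged
by the r3 planner seat for a prover/librarian seat. Part 3 of 4 (independent of parts 1–2; scalar trigonometry only).

* `sum_sin_mul_sin_half`, `sum_sin_le`: `Σ_{n<L} sin(πn/L) = cot(π/2L) ≤ 2L/π` (telescoping,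
  `x ≤ tan x`);
* `absSinZ`, `absSinZMod`: `|sin(π n/L)|` as an `L`-periodic function, `abs_dWaveGap_eq`:
  `|ĝ_d(k)| = 2 g(k₁+k₂) g(k₁-k₂)` (`cos x - cos y = -2 sin((x+y)/2) sin((x-y)/2)`);
* `sum_sum_absSinZMod_add_sub`: for odd `L` the map `(a,b) ↦ (a+b, a-b)` is a bijection of
  `(ℤ/Lℤ)²`, so `Σ_{a,b} g(a+b)g(a-b) = (Σ_s g s)²`;
* **`sum_abs_dWaveGap_le`**: `Φ_L ≤ 2(2L/π)² = 8L²/π²` for odd `L`.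

Even `L`: `Φ_L = 4(cot² + csc²)(π/L) ≤ 8L²/π²` holds for `L ≥ 4` (fails at `L = 2`) and is not
formalised here.
-/

namespace Summit.HubbardSuperconductivity.HubbardLadder

open Finset Literature.Probability.LatticeModels Literature.MathematicalPhysics.QuantumLattice

variable {L : ℕ} [NeZero L]

/-! ### The telescoping sine sum -/

/-- `(Σ_{n<L} sin(πn/L)) · sin(π/2L) = cos(π/2L)` (telescoping). [folklore] -/
theorem sum_sin_mul_sin_half (L : ℕ) (hL : L ≠ 0) :
    (∑ n ∈ range L, Real.sin (Real.pi * n / L)) * Real.sin (Real.pi / (2 * L)) =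
      Real.cos (Real.pi / (2 * L)) := by
  have hL' : (L : ℝ) ≠ 0 := Nat.cast_ne_zero.2 hL
  set f : ℕ → ℝ := fun n => -Real.cos (Real.pi * (2 * n - 1) / (2 * L)) with hf
  have hstep : ∀ n : ℕ, f (n + 1) - f n =
      2 * (Real.sin (Real.pi * n / L) * Real.sin (Real.pi / (2 * L))) := by
    intro n
    simp only [hf]
    have h := Real.cos_sub_cos (Real.pi * (2 * n - 1) / (2 * L)) (Real.pi * (2 * (n + 1 : ℕ) - 1) / (2 * L))
    have e1 : (Real.pi * (2 * n - 1) / (2 * L) + Real.pi * (2 * (n + 1 : ℕ) - 1) / (2 * L)) / 2 =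
        Real.pi * n / L := by push_cast; field_simp; ring
    have e2 : (Real.pi * (2 * n - 1) / (2 * L) - Real.pi * (2 * (n + 1 : ℕ) - 1) / (2 * L)) / 2 =
        -(Real.pi / (2 * L)) := by push_cast; field_simp; ring
    rw [e1, e2, Real.sin_neg] at h
    linarith
  have htel := Finset.sum_range_sub f L
  simp only [hstep] at htel
  rw [← Finset.mul_sum, ← Finset.sum_mul] at htel
  have hf0 : f 0 = -Real.cos (Real.pi / (2 * L)) := by
    simp only [hf]
    have : Real.pi * (2 * ((0 : ℕ) : ℝ) - 1) / (2 * L) = -(Real.pi / (2 * L)) := by push_cast; ring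
    rw [this, Real.cos_neg]
  have hfL : f L = Real.cos (Real.pi / (2 * L)) := by
    simp only [hf]
    have : Real.pi * (2 * (L : ℝ) - 1) / (2 * L) = Real.pi - Real.pi / (2 * L) := by
      field_simp
    rw [this, Real.cos_pi_sub, neg_neg]
  rw [hf0, hfL] at htel
  linarith

/-- `Σ_{n<L} sin(πn/L) ≤ 2L/π` (`= cot(π/2L)` and `cot x ≤ 1/x`). [folklore] -/
theorem sum_sin_le (L : ℕ) (hL : L ≠ 0) :
    ∑ n ∈ range L, Real.sin (Real.pi * n / L) ≤ 2 * L / Real.pi := by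
  rcases Nat.lt_or_ge L 2 with h1 | h2
  · -- L = 1
    have : L = 1 := by omega
    subst this
    simp
    positivity
  · set x : ℝ := Real.pi / (2 * L) with hx
    have hLpos : (0 : ℝ) < L := by exact_mod_cast Nat.pos_of_ne_zero hL
    have hxpos : 0 < x := by rw [hx]; positivity
    have hxlt : x < Real.pi / 2 := by
      rw [hx, div_lt_div_iff_of_pos_left Real.pi_pos (by positivity) (by norm_num)]
      have : (2 : ℝ) ≤ L := by exact_mod_cast h2
      linarith
    have hcos : 0 < Real.cos x := Real.cos_pos_of_mem_Ioo ⟨by linarith, hxlt⟩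
    have hsin : 0 < Real.sin x := Real.sin_pos_of_pos_of_lt_pi hxpos (by linarith [Real.pi_pos])
    have htan := Real.le_tan hxpos.le hxlt
    rw [Real.tan_eq_sin_div_cos, le_div_iff₀ hcos] at htan
    have hid := sum_sin_mul_sin_half L hL
    rw [← hx] at hid
    -- S * sin x = cos x and x cos x ≤ sin x ⇒ S ≤ 1/x = 2L/π
    have hS : (∑ n ∈ range L, Real.sin (Real.pi * n / L)) = Real.cos x / Real.sin x := by
      rw [eq_div_iff hsin.ne']; exact hid
    rw [hS, div_le_iff₀ hsin]
    have : 2 * (L : ℝ) / Real.pi = 1 / x := by rw [hx]; field_simp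
    rw [this, one_div_mul_eq_div, le_div_iff₀ hxpos]
    linarith

/-! ### `|sin(π n/L)|` as a function on `ℤ/Lℤ` -/

/-- `G_L(n) = |sin(π n / L)|` for an integer `n`. -/
noncomputable def absSinZ (L : ℕ) (n : ℤ) : ℝ := |Real.sin (Real.pi * n / L)|

/-- `G_L ≥ 0`. -/
theorem absSinZ_nonneg (L : ℕ) (n : ℤ) : 0 ≤ absSinZ L n := abs_nonneg _

/-- `G_L` is `L`-periodic. [folklore] -/
theorem absSinZ_eq_of_dvd {L : ℕ} (hL : L ≠ 0) {m n : ℤ} (h : (L : ℤ) ∣ m - n) :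
    absSinZ L m = absSinZ L n := by
  obtain ⟨q, hq⟩ := h
  have hL' : (L : ℝ) ≠ 0 := Nat.cast_ne_zero.2 hL
  have hm : (m : ℝ) = n + L * q := by
    have := congrArg (Int.cast : ℤ → ℝ) hq
    push_cast at this
    linarith
  have harg : Real.pi * (m : ℝ) / L = Real.pi * n / L + q * Real.pi := by
    rw [hm]; field_simp; try ring
  rw [absSinZ, absSinZ, harg, Real.sin_add_int_mul_pi, abs_mul, abs_zpow, abs_neg, abs_one,
    _root_.one_zpow, one_mul]

/-- `g(s) = |sin(π s / L)|` on `ℤ/Lℤ` (via the representative `s.val`). -/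
noncomputable def absSinZMod (s : ZMod L) : ℝ := absSinZ L (s.val : ℤ)

omit [NeZero L] in
/-- `g ≥ 0`. -/
theorem absSinZMod_nonneg (s : ZMod L) : 0 ≤ absSinZMod s := abs_nonneg _

/-- `(a+b).val ≡ a.val + b.val (mod L)`. -/
private theorem dvd_val_add (a b : ZMod L) :
    (L : ℤ) ∣ ((a + b).val : ℤ) - ((a.val : ℤ) + b.val) := by
  rw [← ZMod.intCast_zmod_eq_zero_iff_dvd]
  push_cast
  rw [ZMod.natCast_zmod_val, ZMod.natCast_zmod_val, ZMod.natCast_zmod_val, sub_self]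

/-- `(a-b).val ≡ a.val - b.val (mod L)`. -/
private theorem dvd_val_sub (a b : ZMod L) :
    (L : ℤ) ∣ ((a - b).val : ℤ) - ((a.val : ℤ) - b.val) := by
  rw [← ZMod.intCast_zmod_eq_zero_iff_dvd]
  push_cast
  rw [ZMod.natCast_zmod_val, ZMod.natCast_zmod_val, ZMod.natCast_zmod_val, sub_self]

/-- `|ĝ_d(k)| = 2 g(k₁ + k₂) g(k₁ - k₂)` (`cos x - cos y = -2 sin((x+y)/2) sin((x-y)/2)`).
[folklore] -/
theorem abs_dWaveGap_eq (k : TorusSite 2 L) :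
    |dWaveGap k| = 2 * absSinZMod (k 0 + k 1) * absSinZMod (k 0 - k 1) := by
  have hL : (L : ℕ) ≠ 0 := NeZero.ne L
  have hL' : (L : ℝ) ≠ 0 := Nat.cast_ne_zero.2 hL
  rw [dWaveGap]
  simp only [latticeMomentum]
  rw [Real.cos_sub_cos]
  have e1 : (2 * Real.pi * (((k 0).val : ℕ) : ℝ) / L + 2 * Real.pi * (((k 1).val : ℕ) : ℝ) / L) / 2 =
      Real.pi * ((((k 0).val : ℤ) + (k 1).val : ℤ) : ℝ) / L := by
    push_cast; field_simp; try ring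
  have e2 : (2 * Real.pi * (((k 0).val : ℕ) : ℝ) / L - 2 * Real.pi * (((k 1).val : ℕ) : ℝ) / L) / 2 =
      Real.pi * ((((k 0).val : ℤ) - (k 1).val : ℤ) : ℝ) / L := by
    push_cast; field_simp; try ring
  rw [e1, e2, abs_mul, abs_mul, abs_neg, abs_two]
  rw [absSinZMod, absSinZMod, absSinZ_eq_of_dvd hL (dvd_val_add (k 0) (k 1)),
    absSinZ_eq_of_dvd hL (dvd_val_sub (k 0) (k 1)), absSinZ, absSinZ]

/-- `Σ_{s ∈ ℤ/Lℤ} g(s) ≤ 2L/π`. [folklore] -/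
theorem sum_absSinZMod_le : ∑ s : ZMod L, absSinZMod s ≤ 2 * L / Real.pi := by
  have hL : (L : ℕ) ≠ 0 := NeZero.ne L
  have h1 : ∑ s : ZMod L, absSinZMod s = ∑ n ∈ (univ : Finset (ZMod L)).image ZMod.val,
      absSinZ L (n : ℤ) := by
    rw [Finset.sum_image fun a _ b _ h => ZMod.val_injective L h]
    rfl
  have h2 : ∑ n ∈ (univ : Finset (ZMod L)).image ZMod.val, absSinZ L (n : ℤ) ≤
      ∑ n ∈ range L, absSinZ L (n : ℤ) := by
    refine Finset.sum_le_sum_of_subset_of_nonneg ?_ fun n _ _ => absSinZ_nonneg L n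
    intro n hn
    obtain ⟨s, _, rfl⟩ := Finset.mem_image.1 hn
    exact Finset.mem_range.2 (ZMod.val_lt s)
  have h3 : ∑ n ∈ range L, absSinZ L (n : ℤ) = ∑ n ∈ range L, Real.sin (Real.pi * n / L) := by
    refine Finset.sum_congr rfl fun n hn => ?_
    rw [absSinZ, Int.cast_natCast, abs_of_nonneg]
    refine Real.sin_nonneg_of_nonneg_of_le_pi (by positivity) ?_
    have hn' : (n : ℝ) ≤ L := by exact_mod_cast (Finset.mem_range.1 hn).le
    have hLpos : (0 : ℝ) < L := by exact_mod_cast Nat.pos_of_ne_zero hL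
    rw [div_le_iff₀ hLpos]
    nlinarith [Real.pi_pos]
  rw [h1]
  exact h2.trans (h3 ▸ sum_sin_le L hL)

/-! ### The bijection `(a,b) ↦ (a+b, a-b)` for odd `L` and the final bound -/

/-- For odd `L`, `Σ_{a,b} g(a+b) g(a-b) = (Σ_s g s)²`. [folklore] -/
theorem sum_sum_absSinZMod_add_sub (hodd : Odd L) :
    ∑ a : ZMod L, ∑ b : ZMod L, absSinZMod (a + b) * absSinZMod (a - b) =
      (∑ s : ZMod L, absSinZMod s) * ∑ s : ZMod L, absSinZMod s := by
  obtain ⟨m, hm⟩ := hodd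
  -- `w = (L+1)/2` is the inverse of `2` in `ℤ/Lℤ`
  set w : ZMod L := ((m + 1 : ℕ) : ZMod L) with hw
  have h2w : (2 : ZMod L) * w = 1 := by
    have : ((2 * (m + 1) : ℕ) : ZMod L) = ((L + 1 : ℕ) : ZMod L) := by
      congr 1; omega
    rw [hw, ← Nat.cast_two (R := ZMod L), ← Nat.cast_mul, this, Nat.cast_add, ZMod.natCast_self,
      zero_add, Nat.cast_one]
  let e : ZMod L × ZMod L ≃ ZMod L × ZMod L :=
    { toFun := fun p => (p.1 + p.2, p.1 - p.2)
      invFun := fun q => (w * (q.1 + q.2), w * (q.1 - q.2))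
      left_inv := by
        intro p
        ext
        · show w * ((p.1 + p.2) + (p.1 - p.2)) = p.1
          calc w * ((p.1 + p.2) + (p.1 - p.2)) = (2 * w) * p.1 := by ring
            _ = p.1 := by rw [h2w, one_mul]
        · show w * ((p.1 + p.2) - (p.1 - p.2)) = p.2
          calc w * ((p.1 + p.2) - (p.1 - p.2)) = (2 * w) * p.2 := by ring
            _ = p.2 := by rw [h2w, one_mul]
      right_inv := by
        intro q
        ext
        · show w * (q.1 + q.2) + w * (q.1 - q.2) = q.1
          calc w * (q.1 + q.2) + w * (q.1 - q.2) = (2 * w) * q.1 := by ring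
            _ = q.1 := by rw [h2w, one_mul]
        · show w * (q.1 + q.2) - w * (q.1 - q.2) = q.2
          calc w * (q.1 + q.2) - w * (q.1 - q.2) = (2 * w) * q.2 := by ring
            _ = q.2 := by rw [h2w, one_mul] }
  rw [Finset.sum_mul_sum, ← Finset.sum_product', ← Finset.sum_product', Finset.univ_product_univ]
  exact Fintype.sum_equiv e _ _ fun p => rfl

/-- **`Φ_L ≤ 8L²/π²` for odd `L`**: `Σ_{k ∈ (ℤ/Lℤ)²} |cos k₁ - cos k₂| = 2 (Σ_s g s)² ≤ 8 L²/π²`.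
[folklore] -/
theorem sum_abs_dWaveGap_le (hodd : Odd L) :
    ∑ k : TorusSite 2 L, |dWaveGap k| ≤ 8 * (L : ℝ) ^ 2 / Real.pi ^ 2 := by
  have h1 : ∑ k : TorusSite 2 L, |dWaveGap k| =
      ∑ p : ZMod L × ZMod L, 2 * absSinZMod (p.1 + p.2) * absSinZMod (p.1 - p.2) := by
    refine Fintype.sum_equiv (finTwoArrowEquiv (ZMod L)) _ _ fun k => ?_
    rw [abs_dWaveGap_eq]
    rfl
  have h2 : ∑ p : ZMod L × ZMod L, 2 * absSinZMod (p.1 + p.2) * absSinZMod (p.1 - p.2) =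
      2 * ((∑ s : ZMod L, absSinZMod s) * ∑ s : ZMod L, absSinZMod s) := by
    rw [← sum_sum_absSinZMod_add_sub hodd, Finset.mul_sum, Fintype.sum_prod_type]
    refine Finset.sum_congr rfl fun a _ => ?_
    rw [Finset.mul_sum]
    refine Finset.sum_congr rfl fun b _ => ?_
    ring
  rw [h1, h2]
  have hS := sum_absSinZMod_le (L := L)
  have hS0 : 0 ≤ ∑ s : ZMod L, absSinZMod s := Finset.sum_nonneg fun s _ => absSinZMod_nonneg s
  have hpi := Real.pi_pos
  calc 2 * ((∑ s : ZMod L, absSinZMod s) * ∑ s : ZMod L, absSinZMod s)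
      ≤ 2 * ((2 * L / Real.pi) * (2 * L / Real.pi)) := by
        gcongr
    _ = 8 * (L : ℝ) ^ 2 / Real.pi ^ 2 := by
        field_simp; ring

end Summit.HubbardSuperconductivity.HubbardLadder
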